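import Summits.KontsevichZagierPeriods.KontsevichZagierPeriods.Theorems.ValuedFieldSpecialisationCTConstructionBlowupExists
import Literature.NumberTheory.Transcendental.KZFibredRelations

/-!
# Route ValuedFieldSpecialisation — crux `CTConstruction`: the sheared blow-up of a dominated family is dominated

Helper toward crux stmt-KontsevichZagierPeriods-3495 (`CTConstruction`), line `registered`,
reshape r4 (blow-up elimination of the log block), stub `stub_isDominatedFamily_blowup`. A family
is an `(n+1)`-dimensional integral representation `S` read over the parameter `s = z 0`;
`KZ.IsDominatedFamily S r₀ g` (`Literature/NumberTheory/Transcendental/KZDominatedFamily.lean`)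
says that it is dominated near `s = 0⁺` by the envelope `g` with a.e. special fibre `r₀` (the three
hypotheses of Lebesgue's dominated convergence theorem along `𝓝[>] 0`). The **sheared blow-up**
`S₁` of `S` (coordinates `z = (σ, s', x)`, the point fed to `S` being `(σ s', x)`) has domain
`{z | 0 < z 0 < 1, 0 < z 1 < 1, tail (Ψ z) ∈ S.domain}` and integrand `z 1 · S.integrand (tail (Ψ z))`,
`Ψ z = update z 1 (z 1 * z 0)`; its slice over `σ` at the fibre point `y = (s', x)` reads `S` at the
slice point `(s' σ, x)` (`tail_shear_vecCons`).

`stub_isDominatedFamily_blowup`: `S₁` is dominated near `σ = 0⁺` by the constant family `g.cylinder`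
with special fibre the `s'`-WEIGHTED CYLINDER `r₁` over `r₀` (domain
`r₀.cylinder.domain ∩ paramSlab n 0 1`, integrand `y ↦ y 0 ^ 1 · r₀.integrand (tail y)`):
clause (1) with the same `ε` (`0 < s' σ < σ < ε`, `|s' F| ≤ |F|` for `0 < s' < 1`); clauses (2), (3)
at a.e. `y` from those of `S` at `x = tail y` (the preimage of a null set under the tail projection
is null, `volume_setOf_tail_mem_eq_zero`, whence `ae_tail_of_ae`), pulled back along the
reparametrisation `σ ↦ s' σ → 0⁺` (`tendsto_const_mul_nhdsGT_zero_of_pos`).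

Sources: M. Kontsevich, D. Zagier, *Periods* (2001), §1.2; H. Lebesgue (dominated convergence;
substitution in a one-parameter limit, folklore). No new definitions.
-/

noncomputable section

namespace Summit.KontsevichZagierPeriods.ValuedFieldSpecialisation

open MeasureTheory Set Filter
open scoped Topology
open Literature.NumberTheory.Transcendental Literature.NumberTheory.Transcendental.KZ

/-- **Almost-everywhere statements pass to the tail.** If `Q x` holds for a.e. `x : ℝᵐ`, then
`Q (tail y)` holds for a.e. `y : ℝᵐ⁺¹`: the exceptional set is the preimage of a null set under
the tail projection (`volume_setOf_tail_mem_eq_zero`). [folklore] -/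
theorem ae_tail_of_ae {m : ℕ} {Q : (Fin m → ℝ) → Prop} (h : ∀ᵐ x : Fin m → ℝ, Q x) :
    ∀ᵐ y : Fin (m + 1) → ℝ, Q (fun i : Fin m => y i.succ) := by
  rw [ae_iff] at h ⊢
  exact volume_setOf_tail_mem_eq_zero (N := {x | ¬Q x}) h

/-- **The slice of the sheared blow-up.** At the slice point `(σ, y)`, `y = (s', x)`, the point fed
to the blown-up family is `tail (Ψ (σ, y)) = (s' σ, x)`:
`tail (update (vecCons σ y) 1 (y 0 * σ)) = vecCons (y 0 * σ) (tail y)`. [folklore] -/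
theorem tail_shear_vecCons {n : ℕ} (σ : ℝ) (y : Fin (n + 1) → ℝ) :
    (fun i : Fin (n + 1) => Function.update (Matrix.vecCons σ y : Fin (n + 1 + 1) → ℝ) 1
      ((Matrix.vecCons σ y : Fin (n + 1 + 1) → ℝ) 1 * (Matrix.vecCons σ y : Fin (n + 1 + 1) → ℝ) 0)
        i.succ) = Matrix.vecCons (y 0 * σ) (fun i : Fin n => y i.succ) := by
  funext i
  refine Fin.cases ?_ (fun j => ?_) i
  · rw [Fin.succ_zero_eq_one, Function.update_self, Matrix.cons_val_one, Matrix.cons_val_zero,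
      Matrix.cons_val_zero]
  · rw [Function.update_of_ne (Fin.succ_succ_ne_one j)]
    simp only [Matrix.cons_val_succ]

/-- The reparametrisation `t ↦ μ t` of the parameter by `μ > 0` tends to `0⁺` along `0⁺`:
`Tendsto (μ * ·) (𝓝[>] 0) (𝓝[>] 0)`. [folklore] -/
theorem tendsto_const_mul_nhdsGT_zero_of_pos {μ : ℝ} (hμ : 0 < μ) :
    Tendsto (fun t : ℝ => μ * t) (𝓝[>] 0) (𝓝[>] 0) := by
  refine tendsto_nhdsWithin_iff.2 ⟨?_, ?_⟩
  · have h : Tendsto (fun t : ℝ => μ * t) (𝓝 0) (𝓝 (μ * 0)) := (continuous_const_mul μ).tendsto 0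
    rw [mul_zero] at h
    exact h.mono_left nhdsWithin_le_nhds
  · exact eventually_mem_nhdsWithin.mono fun t ht => mul_pos hμ ht

/-- **Stub `stub_isDominatedFamily_blowup` (the sheared blow-up of a dominated family is
dominated).** If `S` (read over `s = z 0`) is dominated near `s = 0⁺` by `g` with a.e. special fibre
`r₀`, then its sheared blow-up `S₁` (domain `{z | 0 < z 0 < 1, 0 < z 1 < 1, tail (Ψ z) ∈ S.domain}`,
integrand `z 1 · S.integrand (tail (Ψ z))`, `Ψ z = update z 1 (z 1 * z 0)`) is dominated near
`σ = 0⁺` by `g.cylinder` with special fibre the `s'`-weighted cylinder `r₁`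
(`r₁.domain = r₀.cylinder.domain ∩ paramSlab n 0 1`, `r₁.integrand y = y 0 ^ 1 · r₀.integrand (tail y)`):
(1) for `z ∈ S₁.domain` with `0 < σ < ε` the point `(s' σ, x) ∈ S.domain` has parameter in `(0, ε)`,
so `x ∈ g.domain`, i.e. `tail z = (s', x) ∈ g.cylinder.domain`, and
`|s' S(s' σ, x)| ≤ |S(s' σ, x)| ≤ g x`; (2), (3) for a.e. `y = (s', x)` (`ae_tail_of_ae`) the slice
membership and the integrand of `S` at `x` converge along `s = s' σ → 0⁺`
(`tendsto_const_mul_nhdsGT_zero_of_pos`), giving `(0 < s' < 1 ∧ x ∈ r₀.domain)` and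
`s' S(s' σ, x) → s' r₀(x)`. [Kontsevich–Zagier 2001, §1.2; Lebesgue] [folklore] -/
theorem stub_isDominatedFamily_blowup : ∀ (n : ℕ) (S : Literature.NumberTheory.Transcendental.KZ.IntegralRep (n + 1)) (r₀ g : Literature.NumberTheory.Transcendental.KZ.IntegralRep n) (S₁ : Literature.NumberTheory.Transcendental.KZ.IntegralRep (n + 1 + 1)) (r₁ : Literature.NumberTheory.Transcendental.KZ.IntegralRep (n + 1)), Literature.NumberTheory.Transcendental.KZ.IsDominatedFamily S r₀ g → S₁.domain = {z | 0 < z 0 ∧ z 0 < 1 ∧ 0 < z 1 ∧ z 1 < 1 ∧ (fun i : Fin (n + 1) => (Function.update z 1 (z 1 * z 0) i.succ : ℝ)) ∈ S.domain} → S₁.integrand = (fun z => z 1 * S.integrand (fun i : Fin (n + 1) => (Function.update z 1 (z 1 * z 0) i.succ : ℝ))) → r₁.domain = r₀.cylinder.domain ∩ Literature.NumberTheory.Transcendental.KZ.paramSlab n 0 1 → r₁.integrand = (fun y => y 0 ^ 1 * r₀.cylinder.integrand y) → Literature.NumberTheory.Transcendental.KZ.IsDominatedFamily S₁ r₁ g.cylinder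 := by
  intro n S r₀ g S₁ r₁ h hdom hint hr₁d hr₁i
  obtain ⟨⟨ε, hε, hbd⟩, hmem, hlim⟩ := h
  refine ⟨⟨ε, hε, fun z hz hz0 hzε => ?_⟩, ?_, ?_⟩
  · -- clause (1): the point `(s' σ, x)` fed to `S` has parameter `s' σ ∈ (0, ε)`
    rw [hdom, mem_setOf_eq] at hz
    obtain ⟨-, -, hz1, hz11, hP⟩ := hz
    have hP0 : Function.update z 1 (z 1 * z 0) (0 : Fin (n + 1)).succ = z 1 * z 0 := by
      rw [Fin.succ_zero_eq_one, Function.update_self]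
    have hPs : ∀ i : Fin n, Function.update z 1 (z 1 * z 0) i.succ.succ = z i.succ.succ :=
      fun i => Function.update_of_ne (Fin.succ_succ_ne_one i) _ _
    have hlt : z 1 * z 0 < ε := (mul_lt_of_lt_one_left hz0 hz11).trans hzε
    obtain ⟨hg, hle⟩ := hbd (fun i : Fin (n + 1) => Function.update z 1 (z 1 * z 0) i.succ) hP
      (by show 0 < Function.update z 1 (z 1 * z 0) (0 : Fin (n + 1)).succ
          rw [hP0]; exact mul_pos hz1 hz0)
      (by show Function.update z 1 (z 1 * z 0) (0 : Fin (n + 1)).succ < ε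
          rw [hP0]; exact hlt)
    simp only [hPs] at hg hle
    refine ⟨⟨hz1, hz11, hg⟩, ?_⟩
    rw [hint, IntegralRep.integrand_cylinder]
    dsimp only
    rw [abs_mul, abs_of_pos hz1]
    exact (mul_le_of_le_one_left (abs_nonneg _) hz11.le).trans hle
  · -- clause (2): slice membership, pulled back along `σ ↦ s' σ`
    filter_upwards [ae_tail_of_ae hmem] with y hy
    by_cases hy0 : 0 < y 0
    · filter_upwards [(tendsto_const_mul_nhdsGT_zero_of_pos hy0).eventually hy,
        Ioo_mem_nhdsGT (zero_lt_one' ℝ)] with σ hσ hσ01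
      rw [hdom, mem_setOf_eq, tail_shear_vecCons σ y, hr₁d]
      simp only [Matrix.cons_val_zero, Matrix.cons_val_one, mem_inter_iff, mem_paramSlab,
        IntegralRep.domain_cylinder, IntegralRep.cylinderDomain, mem_setOf_eq, Rat.cast_zero,
        Rat.cast_one]
      constructor
      · rintro ⟨-, -, h0', h1', hm⟩
        exact ⟨⟨h0', h1', hσ.mp hm⟩, h0', h1'⟩
      · rintro ⟨⟨h0', h1', hm⟩, -, -⟩
        exact ⟨hσ01.1, hσ01.2, h0', h1', hσ.mpr hm⟩
    · -- both sides require `0 < y 0`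
      refine Eventually.of_forall fun σ => iff_of_false (fun h' => hy0 ?_) (fun h' => hy0 ?_)
      · rw [hdom, mem_setOf_eq] at h'
        exact h'.2.2.1
      · rw [hr₁d] at h'
        exact h'.1.1
  · -- clause (3): convergence of the integrands, pulled back along `σ ↦ s' σ`
    filter_upwards [ae_tail_of_ae hlim] with y hy hyr
    rw [hr₁d] at hyr
    obtain ⟨⟨hy0, -, hyt⟩, -⟩ := hyr
    have h1 : Tendsto (fun σ : ℝ => y 0 * S.integrand (Matrix.vecCons (y 0 * σ)
        (fun i : Fin n => y i.succ))) (𝓝[>] 0) (𝓝 (y 0 * r₀.integrand (fun i : Fin n => y i.succ))) :=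
      ((hy hyt).comp (tendsto_const_mul_nhdsGT_zero_of_pos hy0)).const_mul (y 0)
    rw [hr₁i, IntegralRep.integrand_cylinder]
    dsimp only
    rw [pow_one]
    refine h1.congr fun σ => ?_
    rw [hint]
    dsimp only
    rw [tail_shear_vecCons σ y, Matrix.cons_val_one]

end Summit.KontsevichZagierPeriods.ValuedFieldSpecialisation
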